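import Summits.ResolutionOfSingularities.ResolutionOfSingularities.Theorems.FrobeniusLadderFInjectiveMacaulayficationProp44SliceCurveLocal
import Literature.AlgebraicGeometry.Resolution.BlowupReducedDimension
import HarnessLib

/-!
# [CoP1] Prop. 4.4 (`CossartPiltant2008_prop44`, F-71): the `τ = 1` DESCENT — the proof device (stages, links, pending chains) and the
# transport of the marked-point data along near points

[L1 W4.5a · crux `FInjectiveMacaulayfication` (stmt-ResolutionOfSingularities-15315); D-0154 (2) RES inputs cell, seat res-inputs-p-8a (gen 2);
critic R51 (3) «S3 = the isolated τ = 1 point slice, in DESCENT form». PROVED bookkeeping, no new named facts; the structures below are a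
PROOF DEVICE (like `CampaignW46.TauTwoChainState` of the τ ≥ 2 slice), not OURS notions and not statements of the manuscript under adjudication.
AI-written; AI review is weaker than expert review.]

THE POINT (Cossart–Piltant 2008, proof of Prop. 4.4, p. 11: "we get a sequence of points `x_{σ(i)}` … `τ(x_{σ(i)}) = 1` for all `i ≥ 0`
… a contradiction"). The isolated `τ = 1` point slice `stub_tauOne_point` of the patching skeleton and the regular-curve slice are MUTUALLY
RECURSIVE (after blowing up an isolated `τ = 1` point the near locus may be the whole directrix line; the near points over a curve are again
`τ = 1` points), and the recursion is well founded exactly by the chain termination theorem T1 (`stub_T1_false_of_nearChain_tau_one`). The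
companion file `…Prop44SliceTauOnePoint.lean` assembles the point slice from T1, the curve step (p-8b, `…Prop44SliceCurveLocal.lean`), Lemma
4.3 (4) for `Γ′` (T2b′) and the point step, by an infinite DESCENT through the stages defined here:

* `TauOneBase`, `TauOnePt`, `TauOneStage` — a stage: a regular integral Noetherian quasi-excellent `X` of dimension `≤ 3`, `J` with
  `ord ≤ m` and `V(J)` of codimension `≥ 2`, an open `W`, the next centre `Y ⊆ W` (irreducible, regular reduced structure, `ord = m` along
  it, carrying every point of order `≥ m` of `W`), `(W, J|_W, m)` NOT order-reducible, and a marked closed threefold point `x ∈ Y` with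
  `τ(x) = 1`;
* `TauOneLink` — the next stage is the blowing up of the centre with the weak transform, its marked point near and over the marked point;
* `Pending`, `TauOneNext` — finite pre-computed pieces of the descent (a curve lineage has to be followed to its end before the marked
  points on its curves can be chosen: they are the images of the bad point found at the end);
* `spanFinrank_eq_three_of_apply`, `stalkTau_eq_one_of_isNear_curve`, `isClosed_singleton_apply` — the marked-point data (embedding
  dimension `3`, `τ = 1`, closedness) descend from a near point to its image (Lemma 4.3 (2): no near point over a point of a curve centre
  with `τ ≥ 2`).

`CossartPiltant2008_prop44` is NOT proved here; resolution in dimension `≥ 4` / positive characteristic is NOT proved.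

References: V. Cossart, O. Piltant, J. Algebra 320 (2008), Lemma 4.3, Prop. 4.4 (proof, pp. 10–11), Lemma 4.5 [CossartPiltant2008].
-/

-- `Summit.<Summit>.<Sub>.Theorems` with `Sub = Summit` (single-conjunct summit, D-0017)
set_option linter.dupNamespace false

noncomputable section

open CategoryTheory CategoryTheory.Limits AlgebraicGeometry TopologicalSpace IsLocalRing
open Literature.AlgebraicGeometry.Resolution Scheme.IdealSheafData

namespace Summit.ResolutionOfSingularities.ResolutionOfSingularities.Theorems

namespace CP2008Prop44

universe u

/-! ## §1 The proof device: stages of the descent, links, pending chains -/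

/-- PROOF DEVICE (not an OURS notion). **A stage of the `τ = 1` descent without its marked point**: a regular integral Noetherian
quasi-excellent scheme `X` of dimension `≤ 3`, an ideal sheaf `J` with `ord J ≤ m` and `V(J)` of codimension `≥ 2`, an open `W` and
the next CENTRE `Y ⊆ W` (closed, irreducible, with regular reduced structure, `ord J = m` along `Y`) such that every point of order
`≥ m` lies on `Y` or outside `W`, and `(W, J|_W, m)` is NOT order-reducible. [cite: CossartPiltant2008, Prop. 4.4 (proof, pp. 10–11)] -/
structure TauOneBase (m : ℕ) : Type (u + 1) where
  /-- the stage -/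
  X : Scheme.{u}
  /-- the transform of the ideal -/
  J : X.IdealSheafData
  /-- the open over which the instance is not order-reducible -/
  W : X.Opens
  /-- the next centre -/
  Y : Closeds X
  /-- `X` is integral -/
  integral : IsIntegral X
  /-- `X` is Noetherian -/
  noeth : IsNoetherian X
  /-- `X` is regular -/
  reg : Scheme.IsRegular X
  /-- `X` is quasi-excellent -/
  qe : Scheme.IsQuasiExcellent X
  /-- `dim X ≤ 3` -/
  dim3 : topologicalKrullDim X ≤ 3
  /-- `ord J ≤ m` everywhere -/
  le : ∀ z, idealOrder J z ≤ m
  /-- `V(J)` has codimension `≥ 2` -/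
  codim : ∀ z ∈ J.support, 1 < Order.coheight z
  /-- the centre lies in the open -/
  YW : (Y : Set X) ⊆ (W : Set X)
  /-- the centre is irreducible -/
  Yirr : IsIrreducible (Y : Set X)
  /-- the centre with its reduced structure is regular -/
  Yreg : Scheme.IsRegular (vanishingIdeal Y).subscheme
  /-- `ord J = m` along the centre -/
  Yord : ∀ z ∈ (Y : Set X), idealOrder J z = m
  /-- the regime: points of order `≥ m` lie on the centre or outside the open -/
  bad : ∀ z : X, (m : ℕ∞) ≤ idealOrder J z → z ∈ (Y : Set X) ∨ z ∉ (W : Set X)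
  /-- `(W, J|_W, m)` is not order-reducible -/
  notRed : ¬ CampaignW46.OrderReducible (J.comap W.ι) m

/-- PROOF DEVICE. **The marked point of a stage**: a closed threefold point of the centre with `τ = 1` there.
[cite: CossartPiltant2008, Prop. 4.4 (proof, p. 11)] -/
structure TauOnePt {m : ℕ} (b : TauOneBase.{u} m) : Type u where
  /-- the marked point `x_n` -/
  x : b.X
  /-- `x_n ∈ Y_n` -/
  xY : x ∈ (b.Y : Set b.X)
  /-- `x_n` is closed -/
  closed : IsClosed ({x} : Set b.X)
  /-- embedding dimension `3` at `x_n` -/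
  dim : (maximalIdeal (b.X.presheaf.stalk x)).spanFinrank = 3
  /-- `τ(x_n) = 1` -/
  tau : haveI := b.reg x; stalkTau b.J x m = 1

/-- PROOF DEVICE. A stage of the descent: base data and a marked point. [cite: CossartPiltant2008, Prop. 4.4 (proof, p. 11)] -/
structure TauOneStage (m : ℕ) : Type (u + 1) where
  /-- the base data -/
  base : TauOneBase.{u} m
  /-- the marked point -/
  pt : TauOnePt base

/-- PROOF DEVICE. **A link of the descent**: the next stage is reached by blowing up the centre, its ideal is the weak transform,
and its marked point is a near point over the marked point. [cite: CossartPiltant2008, Prop. 4.4 (proof, p. 11)] -/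
structure TauOneLink {m : ℕ} (s t : TauOneStage.{u} m) : Type u where
  /-- the blowing up `X_{n+1} → X_n` -/
  π : t.base.X ⟶ s.base.X
  /-- it is a blowing up of the centre -/
  blowup : IsBlowup π (vanishingIdeal s.base.Y)
  /-- the ideal of the next stage is the weak transform -/
  transform : t.base.J = controlledTransform π (vanishingIdeal s.base.Y) s.base.J m
  /-- the marked points are compatible -/
  apply_x : π t.pt.x = s.pt.x
  /-- the next marked point is near -/
  near : IsNear π (vanishingIdeal s.base.Y) s.base.J m t.pt.x

/-- PROOF DEVICE. **A pending chain**: a finite piece of the descent already computed (the curve lineages have to be computed down to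
their end before the marked points on them can be chosen), ending in a stage whose centre is its marked point.
[cite: CossartPiltant2008, Prop. 4.4 (proof, p. 11)] -/
inductive Pending {m : ℕ} : TauOneStage.{u} m → Type (u + 1)
  /-- a point stage, nothing computed beyond it -/
  | last {s : TauOneStage.{u} m} (hpt : (s.base.Y : Set s.base.X) = {s.pt.x}) : Pending s
  /-- a stage followed by a computed link -/
  | cons {s : TauOneStage.{u} m} (t : TauOneStage.{u} m) (l : TauOneLink s t) (rest : Pending t) : Pending s

/-- PROOF DEVICE. The next stage with its link and pending chain. [cite: CossartPiltant2008, Prop. 4.4 (proof, p. 11)] -/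
structure TauOneNext {m : ℕ} (s : TauOneStage.{u} m) : Type (u + 1) where
  /-- the next stage -/
  t : TauOneStage.{u} m
  /-- the link to it -/
  link : TauOneLink s t
  /-- the pending chain from it -/
  rest : Pending t

/-! ## §2 Point data transported along near points -/

/-- **Embedding dimension `3` descends**: if `x′` over `x` has embedding dimension `3` (blow-up of a regular scheme of dimension `≤ 3`,
`X′` regular), then so has `x`. [folklore] -/
theorem spanFinrank_eq_three_of_apply {X X' : Scheme.{u}} [IsLocallyNoetherian X] [IsLocallyNoetherian X'] {π : X' ⟶ X}
    {C : X.IdealSheafData} (hπ : IsBlowup π C) (hX : Scheme.IsRegular X) (hX' : Scheme.IsRegular X')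
    (hX3 : topologicalKrullDim X ≤ 3) {x' : X'} (hd : (maximalIdeal (X'.presheaf.stalk x')).spanFinrank = 3) :
    (maximalIdeal (X.presheaf.stalk (π x'))).spanFinrank = 3 := by
  haveI := hX (π x')
  haveI := hX' x'
  have h1 : ringKrullDim (X'.presheaf.stalk x') ≤ ringKrullDim (X.presheaf.stalk (π x')) :=
    hπ.ringKrullDim_stalk_le_of_isLocallyNoetherian x'
  have h2 : ringKrullDim (X.presheaf.stalk (π x')) ≤ (3 : ℕ) := by
    rw [ringKrullDim_stalk_eq_coheight]
    have h := (topologicalKrullDim_le_iff_forall_coheight_le X 3).mp hX3 (π x')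
    exact WithBot.coe_le_coe.mpr h
  have h3 : ringKrullDim (X'.presheaf.stalk x') = (3 : ℕ) := by
    rw [← IsRegularLocalRing.spanFinrank_maximalIdeal, hd]
  have h4 : ((maximalIdeal (X.presheaf.stalk (π x'))).spanFinrank : WithBot ℕ∞) =
      ringKrullDim (X.presheaf.stalk (π x')) :=
    IsRegularLocalRing.spanFinrank_maximalIdeal
  have h5 : ringKrullDim (X.presheaf.stalk (π x')) = (3 : ℕ) := le_antisymm h2 (h3 ▸ h1)
  rw [h5] at h4
  exact_mod_cast h4

/-- **`τ = 1` at a point of a curve centre with a near point over it** (Lemma 4.3 (2): no near point over a point with `τ ≥ 2`).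
[cite: CossartPiltant2008, Lemma 4.3 (2)] -/
theorem stalkTau_eq_one_of_isNear_curve {m : ℕ} (hm : 1 ≤ m) {X X' : Scheme.{u}} [IsLocallyNoetherian X]
    [IsLocallyNoetherian X'] (hX : Scheme.IsRegular X) (hX3 : topologicalKrullDim X ≤ 3) {J : X.IdealSheafData}
    {Y : Closeds X} {η : X} (hYη : (Y : Set X) = closure {η}) (hcoh : Order.coheight η = 2)
    (hreg : Scheme.IsRegular (vanishingIdeal Y).subscheme) (hord : ∀ y ∈ (Y : Set X), idealOrder J y = m)
    {π : X' ⟶ X} (hπ : IsBlowup π (vanishingIdeal Y)) {x' : X'} (hx : π x' ∈ (Y : Set X))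
    (hnear : IsNear π (vanishingIdeal Y) J m x') :
    haveI := hX (π x'); stalkTau J (π x') m = 1 := by
  haveI := hX (π x')
  have hcoh3 : ∀ z : X, Order.coheight z ≤ 3 := (topologicalKrullDim_le_iff_forall_coheight_le X 3).mp hX3
  obtain ⟨c, hcr, hcY⟩ := exists_rsopPair_of_mem_curve hX hcoh3 hreg hYη hcoh hx
  have h1 : 1 ≤ stalkTau J (π x') m := one_le_stalkTau J (π x') hm (hord _ hx)
  by_contra hne
  have h2 : 2 ≤ stalkTau J (π x') m := by omega
  exact hπ.not_isNear_of_two_le_stalkTau hX hreg hm hord hcr hcY h2 hnear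


/-- The image of a closed point under a blowing up (a proper map) is a closed point. [folklore] -/
theorem isClosed_singleton_apply {X X' : Scheme.{u}} [IsLocallyNoetherian X] {π : X' ⟶ X} {C : X.IdealSheafData}
    (hπ : IsBlowup π C)
    {x' : X'} (hx' : IsClosed ({x'} : Set X')) : IsClosed ({π x'} : Set X) := by
  haveI := hπ.isProper
  have h := π.isClosedMap _ hx'
  rwa [Set.image_singleton] at h

end CP2008Prop44

end Summit.ResolutionOfSingularities.ResolutionOfSingularities.Theorems

end
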